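import Mathlib
import Summits.CriticalPhenomena.PercolationContinuityZ3.Theorems.PercNearOneGluingNoHeavyLowerTailOrientedAntipodalHall

/-!
# Two labellings, one opposite type-pair: the full-star count via Harris–Kleitman

Helper file for crux `stmt-CriticalPhenomena-4575` (`NoHeavyLowerTail`, route `PercNearOneGluingNoHeavy`), hull-port seat `prim-hp-7`
(generation 59); `--supports stmt-CriticalPhenomena-4575`.  Everything here is PROVED; no definitions, no `sorry`.

Setting (`…AntipodalStrongHarris`): labels `Lab k` (`B < C_p < A`), TWO monotone labellings `g h : Finset α → Lab k` of the subsets of a finite type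
(no order relation between `g` and `h` is assumed), complements `qᶜ = univ \\ q`.  For a labelling `f` of `2^S` and a point `e`, the pair
`(g, h) = (f (· ∪ {e}), f)` on `S \\ {e}` encodes the sets through `e`: `q ∪ {e}` is a good iff `g q = A ∧ h qᶜ = B`, a bad of type `(a,b)` iff
`(g q, h qᶜ) = (C_a, C_b)`.

**Theorem (`card_straddle_pairs_le_card_goods`).**  For petals `a ≠ b`,
`#{q : g q ∈ {C_a, A}, h q ∈ {B, C_a}, g qᶜ ∈ {C_b, A}, h qᶜ ∈ {B, C_b}} ≤ #{q : g q = A, h qᶜ = B}`.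
The left side counts, once each, every complement pair `{q, qᶜ}` one of whose members is a bad of type `(a,b)` or `(b,a)` of the pair `(g,h)` with
`h ≤ g` at `q` and at `qᶜ` (and a few non-bad pairs); so for ONE opposite type-pair `{ab, ba}` the 'full-star count' `#goods ≥ #clean member pairs`
holds for arbitrary pairs of labellings — the two-petal case of hp-7's Conjecture FS′ (memo `prim-hp-7/FROM-prim-hp-7-g59-T6-EXACT.md` §3), whose
three-petal case (all three opposite pairs simultaneously) is open.  Proof: `𝒳 = {g q ≥ C_a, h qᶜ ≤ C_b}` and `𝒴 = {g q ≥ C_b, h qᶜ ≤ C_a}` are up-sets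
with `𝒳 ∩ 𝒴 ⊆ goods`, the left side is `𝒳 ∩ 𝒴ᶜ*` with `𝒴ᶜ* = {qᶜ : q ∈ 𝒴}` a down-set of the same size as `𝒴`, and Harris–Kleitman gives
`2^n #(𝒳 ∩ 𝒴ᶜ*) ≤ #𝒳 · #𝒴 ≤ 2^n #(𝒳 ∩ 𝒴)`.  (prim-hp-7 gen 59, 2026-08-23.)
-/

namespace Summit.CriticalPhenomena.PercolationContinuityZ3.Theorems

namespace OrientedAntipodalHall

open Finset AntipodalStrongHarris AntipodalStrongHarris.Lab

variable {α : Type*} [Fintype α] [DecidableEq α] {k : ℕ}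

omit [Fintype α] [DecidableEq α] in
/-- `C_a ≤ x` in `Lab k` means `x = C_a` or `x = A`. -/
theorem petal_le_iff {a : Fin k} {x : Lab k} : petal a ≤ x ↔ x = petal a ∨ x = top := by
  rw [le_def]
  constructor
  · rintro (h | h | h)
    · exact absurd h (by simp)
    · exact Or.inr h
    · exact Or.inl h.symm
  · rintro (h | h)
    · exact Or.inr (Or.inr h.symm)
    · exact Or.inr (Or.inl h)

omit [Fintype α] [DecidableEq α] in
/-- `x ≤ C_a` in `Lab k` means `x = B` or `x = C_a`. -/
theorem le_petal_iff {a : Fin k} {x : Lab k} : x ≤ petal a ↔ x = bot ∨ x = petal a := by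
  rw [le_def]
  constructor
  · rintro (h | h | h)
    · exact Or.inl h
    · exact absurd h (by simp)
    · exact Or.inr h
  · rintro (h | h)
    · exact Or.inl h
    · exact Or.inr (Or.inr h)

omit [Fintype α] [DecidableEq α] in
/-- Transitivity of the label order (proved from `le_def`). -/
theorem lab_le_trans {x y z : Lab k} (hxy : x ≤ y) (hyz : y ≤ z) : x ≤ z := by
  rw [le_def] at hxy hyz ⊢
  rcases hxy with h | h | h
  · exact Or.inl h
  · subst h
    rcases hyz with h' | h' | h'
    · exact absurd h' (by simp)
    · exact Or.inr (Or.inl h')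
    · exact Or.inr (Or.inl h'.symm)
  · subst h
    exact hyz

/-- **One opposite type-pair: straddle pairs are at most as many as goods** (Harris–Kleitman twice).  `g, h` monotone labellings of the
subsets of a finite type, `a ≠ b` petals.  The sets `q` with `g q ≥ C_a ≥ h q` and `g qᶜ ≥ C_b ≥ h qᶜ` (spelled out as label equalities) are at most as many as the
sets `q` with `g q = A` and `h qᶜ = B`. -/
theorem card_straddle_pairs_le_card_goods (g h : Finset α → Lab k)
    (hg : ∀ ⦃X Y : Finset α⦄, X ⊆ Y → g X ≤ g Y) (hh : ∀ ⦃X Y : Finset α⦄, X ⊆ Y → h X ≤ h Y)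
    {a b : Fin k} (hab : a ≠ b) :
    #{q ∈ (univ : Finset (Finset α)) | (g q = petal a ∨ g q = top) ∧ (h q = bot ∨ h q = petal a) ∧
        (g (univ \ q) = petal b ∨ g (univ \ q) = top) ∧ (h (univ \ q) = bot ∨ h (univ \ q) = petal b)} ≤
      #{q ∈ (univ : Finset (Finset α)) | g q = top ∧ h (univ \ q) = bot} := by
  classical
  -- the two up-sets
  set X : Finset (Finset α) := {q ∈ (univ : Finset (Finset α)) | petal a ≤ g q ∧ h (univ \ q) ≤ petal b} with hX
  set Y : Finset (Finset α) := {q ∈ (univ : Finset (Finset α)) | petal b ≤ g q ∧ h (univ \ q) ≤ petal a} with hY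
  -- the reflection of `Y`
  set Yc : Finset (Finset α) := Y.image (fun q => univ \ q) with hYc
  have hmemX : ∀ q, q ∈ X ↔ petal a ≤ g q ∧ h (univ \ q) ≤ petal b := fun q => by simp [hX]
  have hmemY : ∀ q, q ∈ Y ↔ petal b ≤ g q ∧ h (univ \ q) ≤ petal a := fun q => by simp [hY]
  have hcc : ∀ q : Finset α, univ \ (univ \ q) = q := fun q => by
    rw [Finset.sdiff_sdiff_eq_self (subset_univ q)]
  have hmemYc : ∀ q, q ∈ Yc ↔ petal b ≤ g (univ \ q) ∧ h q ≤ petal a := by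
    intro q
    rw [hYc, mem_image]
    constructor
    · rintro ⟨r, hr, rfl⟩
      rw [hmemY] at hr
      rw [hcc]
      exact ⟨hr.1, hr.2⟩
    · rintro ⟨h1, h2⟩
      refine ⟨univ \ q, ?_, hcc q⟩
      rw [hmemY, hcc]
      exact ⟨h1, h2⟩
  -- monotonicity of the defining conditions
  have hXup : IsUpperSet (X : Set (Finset α)) := by
    intro q r hqr hq
    rw [mem_coe, hmemX] at hq ⊢
    have h1 : g q ≤ g r := hg hqr
    have h2 : h (univ \ r) ≤ h (univ \ q) := hh (sdiff_subset_sdiff subset_rfl hqr)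
    exact ⟨lab_le_trans hq.1 h1, lab_le_trans h2 hq.2⟩
  have hYup : IsUpperSet (Y : Set (Finset α)) := by
    intro q r hqr hq
    rw [mem_coe, hmemY] at hq ⊢
    have h1 : g q ≤ g r := hg hqr
    have h2 : h (univ \ r) ≤ h (univ \ q) := hh (sdiff_subset_sdiff subset_rfl hqr)
    exact ⟨lab_le_trans hq.1 h1, lab_le_trans h2 hq.2⟩
  have hYcdown : IsLowerSet (Yc : Set (Finset α)) := by
    intro q r hrq hq
    rw [mem_coe, hmemYc] at hq ⊢
    have h1 : g (univ \ q) ≤ g (univ \ r) := hg (sdiff_subset_sdiff subset_rfl hrq)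
    have h2 : h r ≤ h q := hh hrq
    exact ⟨lab_le_trans hq.1 h1, lab_le_trans h2 hq.2⟩
  -- cardinalities
  have hcardYc : #Yc = #Y := by
    rw [hYc]
    refine card_image_of_injOn fun q _ r _ hqr => ?_
    have := congrArg (fun s => (univ : Finset α) \ s) hqr
    simpa only [hcc] using this
  have hHarris : #X * #Y ≤ 2 ^ Fintype.card α * #(X ∩ Y) := hXup.le_card_inter_finset hYup
  have hKleitman : 2 ^ Fintype.card α * #(X ∩ Yc) ≤ #X * #Yc := hXup.card_inter_le_finset hYcdown
  have hpow : 0 < 2 ^ Fintype.card α := by positivity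
  have hchain : #(X ∩ Yc) ≤ #(X ∩ Y) := by
    have : 2 ^ Fintype.card α * #(X ∩ Yc) ≤ 2 ^ Fintype.card α * #(X ∩ Y) := by
      calc 2 ^ Fintype.card α * #(X ∩ Yc) ≤ #X * #Yc := hKleitman
        _ = #X * #Y := by rw [hcardYc]
        _ ≤ 2 ^ Fintype.card α * #(X ∩ Y) := hHarris
    exact Nat.le_of_mul_le_mul_left this hpow
  -- identify the two sides
  have hL : {q ∈ (univ : Finset (Finset α)) | (g q = petal a ∨ g q = top) ∧ (h q = bot ∨ h q = petal a) ∧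
        (g (univ \ q) = petal b ∨ g (univ \ q) = top) ∧ (h (univ \ q) = bot ∨ h (univ \ q) = petal b)} = X ∩ Yc := by
    ext q
    simp only [mem_inter, mem_filter, mem_univ, true_and, hmemX, hmemYc, petal_le_iff, le_petal_iff]
    constructor
    · rintro ⟨h1, h2, h3, h4⟩
      exact ⟨⟨h1, h4⟩, h3, h2⟩
    · rintro ⟨⟨h1, h4⟩, h3, h2⟩
      exact ⟨h1, h2, h3, h4⟩
  have hR : X ∩ Y ⊆ {q ∈ (univ : Finset (Finset α)) | g q = top ∧ h (univ \ q) = bot} := by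
    intro q hq
    rw [mem_inter, hmemX, hmemY] at hq
    rw [mem_filter]
    exact ⟨mem_univ _, eq_top_of_petal_le hab hq.1.1 hq.2.1, eq_bot_of_le_petal hab hq.2.2 hq.1.2⟩
  rw [hL]
  exact hchain.trans (card_le_card hR)

end OrientedAntipodalHall

end Summit.CriticalPhenomena.PercolationContinuityZ3.Theorems
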